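import Summits.Ventures.Crystal3D.Theorems.StickyWulffConstantGenericWallFloorStackWalkWordSepFarTwo
import Summits.Ventures.Crystal3D.Theorems.StickyWulffConstantGenericWallFloorStackWalkWordSepTwo
import Summits.Ventures.Crystal3D.Theorems.StickyWulffConstantCoaxialWallLawExitsBelow
import HarnessLib

/-!
# `Σ27`, cell `(1,1)`: both grains one step into their lamellae — the only co-axial cross pair is the in-plane twin
# pair about the MIDDLE plane (crux `GenericWallFloor`, stmt-Ventures-19480, line `WallLedgerG`)

HONEST FRAMING. Venture `Summits/Ventures/Crystal3D` (cell `crystal3d-full`), helper `--supports` the crux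
`GenericWallFloor` of `route-Ventures-StickyWulffConstant`, REGISTERED line `WallLedgerG`, open stub
`stub_twoSlabAdhesion`.  Rung credit only; F-C1 not moved; NOT the crux.
THE CLASS.  A chain pair at twin distance three, `A₂·Λ₀ = (wordFrame A₁ [μ₃, μ₂, μ₁])·Λ₀` (reduced; tree
`A₁ –1– T₁ –2– T₂ –3– A₂`), both steep slots FREE at level one, with the LEVEL-TWO conditions of `…WordSepTwo` (near:
`hsecond₁`, if grain 1 pushes through plane 1 its best capper does not force plane 2) and `…WordSepFarTwo` (far:
`hsecond₂`), plus their geometric readings `hcap₁` / `hcap₂` (those cappers lie IN plane 2).  R41t cell `(l,c) = (1,1)`,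
numerically `9.5 %` of Haar `Σ27` orientations (seat folder `calc/cells_k3.py`; cells `l + c ≤ 1` = 71 % are separated by
19480-p2 g4).  **`inPlaneTwin_of_coaxial_sigma27`**: if the tops of a sound well-formed grain-1 stack and of a grain-2 stack
carry CO-AXIAL frames, then both are the level-one lamella entries (`T₁`, `T₂`), mirror twins about the middle plane
`ν` with both walk directions in it — the hypothesis list of `InPlaneTwinStarPair` (a tree theorem,
`inPlaneTwinStarPair_holds`).  Proof: `not_coaxial_of_word_farTwo`'s transported far word + `not_coaxial_of_word_two`'s
endgame; the one surviving branch is the cancelled junction with one-letter words on both sides.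
WHAT THIS IS NOT: not the stub; the `c₀ = 1` assembly is the sequel; F-C1 not moved.
-/

noncomputable section

namespace Summit.Ventures.Crystal3D.Theorems

open Summit.Ventures.Crystal3D Finset
open Literature.MathematicalPhysics.StatisticalMechanics (fccStacking barlowStacking IsHaggSeq)
open scoped InnerProductSpace

/-- **Cell `(1,1)` at twin distance three: the co-axial cross pair is the in-plane twin pair about the middle plane.** -/
theorem inPlaneTwin_of_coaxial_sigma27 {A₁ A₂ : EuclideanSpace ℝ (Fin 3) ≃ₗᵢ[ℝ] EuclideanSpace ℝ (Fin 3)}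
    {u₁ u₂ : EuclideanSpace ℝ (Fin 3)} (μ₃ μ₂ μ₁ : EuclideanSpace ℝ (Fin 3))
    (hκl : ∀ μ ∈ [μ₃, μ₂, μ₁], ‖μ‖ = 1 ∧
      ∀ w ∈ fccSlots, ⟪w, μ⟫_ℝ = 0 ∨ ⟪w, μ⟫_ℝ = Real.sqrt (2 / 3) ∨ ⟪w, μ⟫_ℝ = -Real.sqrt (2 / 3))
    (hκc : List.IsChain (fun μ μ' => ⟪μ, μ'⟫_ℝ = 1 / 3 ∨ ⟪μ, μ'⟫_ℝ = -1 / 3) [μ₃, μ₂, μ₁])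
    (hA₂ : A₂ '' fccStacking 1 (Real.sqrt (2 / 3)) = (wordFrame A₁ [μ₃, μ₂, μ₁]) '' fccStacking 1 (Real.sqrt (2 / 3)))
    {z₁ z₂ : EuclideanSpace ℝ (Fin 3)}
    (hsecond₁ : ∀ n₁ : EuclideanSpace ℝ (Fin 3), (n₁ = A₁ μ₁ ∨ n₁ = -A₁ μ₁) → ⟪A₁ u₁, n₁⟫_ℝ = Real.sqrt (2 / 3) →
      ∀ q ∈ fccSlots, 0 < ⟪twinFrame A₁ n₁ q, n₁⟫_ℝ →
        (∀ q' ∈ fccSlots, 0 < ⟪twinFrame A₁ n₁ q', n₁⟫_ℝ → ⟪twinFrame A₁ n₁ q', z₁⟫_ℝ ≤ ⟪twinFrame A₁ n₁ q, z₁⟫_ℝ) →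
        (twinFrame A₁ n₁).symm ((2 * Real.sqrt (2 / 3)) • twinFrame A₁ n₁ q - n₁) ≠ μ₂ ∧
        (twinFrame A₁ n₁).symm ((2 * Real.sqrt (2 / 3)) • twinFrame A₁ n₁ q - n₁) ≠ -μ₂)
    (hcap₁ : ∀ n₁ : EuclideanSpace ℝ (Fin 3), (n₁ = A₁ μ₁ ∨ n₁ = -A₁ μ₁) → ⟪A₁ u₁, n₁⟫_ℝ = Real.sqrt (2 / 3) →
      ∀ q ∈ fccSlots, 0 < ⟪twinFrame A₁ n₁ q, n₁⟫_ℝ →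
        (∀ q' ∈ fccSlots, 0 < ⟪twinFrame A₁ n₁ q', n₁⟫_ℝ → ⟪twinFrame A₁ n₁ q', z₁⟫_ℝ ≤ ⟪twinFrame A₁ n₁ q, z₁⟫_ℝ) →
        ⟪q, μ₂⟫_ℝ = 0)
    (hsecond₂ : ∀ n₁ : EuclideanSpace ℝ (Fin 3),
      (n₁ = wordFrame A₁ [μ₃, μ₂, μ₁] μ₃ ∨ n₁ = -wordFrame A₁ [μ₃, μ₂, μ₁] μ₃) → ⟪A₂ u₂, n₁⟫_ℝ = Real.sqrt (2 / 3) →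
      ∀ q ∈ fccSlots, 0 < ⟪twinFrame A₂ n₁ q, n₁⟫_ℝ →
        (∀ q' ∈ fccSlots, 0 < ⟪twinFrame A₂ n₁ q', n₁⟫_ℝ → ⟪twinFrame A₂ n₁ q', z₂⟫_ℝ ≤ ⟪twinFrame A₂ n₁ q, z₂⟫_ℝ) →
        (wordFrame A₁ [μ₃, μ₂, μ₁]).symm (A₂ ((twinFrame A₂ n₁).symm ((2 * Real.sqrt (2 / 3)) • twinFrame A₂ n₁ q - n₁))) ≠ μ₂ ∧
        (wordFrame A₁ [μ₃, μ₂, μ₁]).symm (A₂ ((twinFrame A₂ n₁).symm ((2 * Real.sqrt (2 / 3)) • twinFrame A₂ n₁ q - n₁))) ≠ -μ₂)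
    (hcap₂ : ∀ n₁ : EuclideanSpace ℝ (Fin 3),
      (n₁ = wordFrame A₁ [μ₃, μ₂, μ₁] μ₃ ∨ n₁ = -wordFrame A₁ [μ₃, μ₂, μ₁] μ₃) → ⟪A₂ u₂, n₁⟫_ℝ = Real.sqrt (2 / 3) →
      ∀ q ∈ fccSlots, 0 < ⟪twinFrame A₂ n₁ q, n₁⟫_ℝ →
        (∀ q' ∈ fccSlots, 0 < ⟪twinFrame A₂ n₁ q', n₁⟫_ℝ → ⟪twinFrame A₂ n₁ q', z₂⟫_ℝ ≤ ⟪twinFrame A₂ n₁ q, z₂⟫_ℝ) →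
        ⟪twinFrame A₂ n₁ q, twinFrame A₁ (A₁ μ₁) μ₂⟫_ℝ = 0)
    {e₁ e₂ : WalkEntry} {rest₁ rest₂ : List WalkEntry}
    (hS₁ : StackSound z₁ (e₁ :: rest₁)) (hW₁ : StackWF z₁ (e₁ :: rest₁)) (hl₁ : (e₁ :: rest₁).getLast? = some ⟨A₁, u₁, 0⟩)
    (hS₂ : StackSound z₂ (e₂ :: rest₂)) (hW₂ : StackWF z₂ (e₂ :: rest₂)) (hl₂ : (e₂ :: rest₂).getLast? = some ⟨A₂, u₂, 0⟩)
    (hco : ∃ (L : EuclideanSpace ℝ (Fin 3) ≃ₗᵢ[ℝ] EuclideanSpace ℝ (Fin 3))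
        (s₁ s₂ : EuclideanSpace ℝ (Fin 3)) (σ σ' : ℤ → ℤ), IsHaggSeq σ ∧ IsHaggSeq σ' ∧
        e₁.frame '' fccStacking 1 (Real.sqrt (2 / 3)) ⊆ (fun p => L p + s₁) '' barlowStacking 1 (Real.sqrt (2 / 3)) σ ∧
        e₂.frame '' fccStacking 1 (Real.sqrt (2 / 3)) ⊆ (fun p => L p + s₂) '' barlowStacking 1 (Real.sqrt (2 / 3)) σ') :
    ∃ ν : EuclideanSpace ℝ (Fin 3), ‖ν‖ = 1 ∧
      (∀ w ∈ fccSlots, ⟪e₁.frame w, ν⟫_ℝ = 0 ∨ ⟪e₁.frame w, ν⟫_ℝ = Real.sqrt (2 / 3) ∨ ⟪e₁.frame w, ν⟫_ℝ = -Real.sqrt (2 / 3)) ∧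
      e₂.frame '' fccStacking 1 (Real.sqrt (2 / 3)) = twinFrame e₁.frame ν '' fccStacking 1 (Real.sqrt (2 / 3)) ∧
      ⟪e₁.frame e₁.dir, ν⟫_ℝ = 0 ∧ ⟪e₂.frame e₂.dir, ν⟫_ℝ = 0 := by
  set κ := [μ₃, μ₂, μ₁] with hκdef
  have hr : 0 < Real.sqrt (2 / 3) := Real.sqrt_pos.2 (by norm_num)
  have hμ₃ := hκl μ₃ (by rw [hκdef]; simp); have hμ₂ := hκl μ₂ (by rw [hκdef]; simp); have hμ₁ := hκl μ₁ (by rw [hκdef]; simp)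
  -- the two stack words and P2 on both sides
  obtain ⟨hαl, hαc⟩ := stackWord_letters _ hS₁ hW₁; obtain ⟨hβl, hβc⟩ := stackWord_letters _ hS₂ hW₂
  have hF₁ : e₁.frame = wordFrame A₁ (stackWord (e₁ :: rest₁)) := by rw [frame_eq_wordFrame e₁ rest₁ hS₁, stackBase_eq_of_getLast? hl₁]
  have hF₂ : e₂.frame = wordFrame A₂ (stackWord (e₂ :: rest₂)) := by rw [frame_eq_wordFrame e₂ rest₂ hS₂, stackBase_eq_of_getLast? hl₂]
  have hP2 := stackWord_lastTwo_ne (z := z₁) hμ₁.1 hμ₂.1 hsecond₁ rest₁ e₁ hS₁ hW₁ hl₁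
  -- the lattice symmetry `S = W⁻¹ ∘ A₂` and the transported far word
  obtain ⟨S, hS⟩ : ∃ S : EuclideanSpace ℝ (Fin 3) ≃ₗᵢ[ℝ] EuclideanSpace ℝ (Fin 3), S = A₂.trans (wordFrame A₁ κ).symm := ⟨_, rfl⟩
  have hWS : ∀ x, wordFrame A₁ κ (S x) = A₂ x := fun x => by rw [hS, LinearIsometryEquiv.trans_apply, LinearIsometryEquiv.apply_symm_apply]
  have hA₂eq : A₂ = S.trans (wordFrame A₁ κ) := LinearIsometryEquiv.ext fun x => by rw [LinearIsometryEquiv.trans_apply, hWS]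
  have hSfcc : S '' fccStacking 1 (Real.sqrt (2 / 3)) = fccStacking 1 (Real.sqrt (2 / 3)) := by
    rw [hS, LinearIsometryEquiv.coe_trans, Set.image_comp, hA₂, Set.image_image]; simp
  have hSslots := image_fccSlots_eq_self_of_image_fcc S hSfcc
  have hSmem' : ∀ w ∈ fccSlots, S.symm w ∈ fccSlots := fun w hw => by
    have hw' : w ∈ (S : EuclideanSpace ℝ (Fin 3) → EuclideanSpace ℝ (Fin 3)) '' ↑fccSlots := by
      rw [hSslots]; exact Finset.mem_coe.2 hw
    obtain ⟨w', hw', hw'eq⟩ := hw'; rw [← hw'eq, LinearIsometryEquiv.symm_apply_apply]; exact Finset.mem_coe.1 hw'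
  set β := stackWord (e₂ :: rest₂) with hβ
  have hβSl : ∀ μ ∈ β.map S, ‖μ‖ = 1 ∧
      ∀ w ∈ fccSlots, ⟪w, μ⟫_ℝ = 0 ∨ ⟪w, μ⟫_ℝ = Real.sqrt (2 / 3) ∨ ⟪w, μ⟫_ℝ = -Real.sqrt (2 / 3) := by
    intro μ hμ; obtain ⟨ν, hν, rfl⟩ := List.mem_map.1 hμ; obtain ⟨hνu, hνm⟩ := hβl ν hν
    refine ⟨by rw [LinearIsometryEquiv.norm_map, hνu], fun w hw => ?_⟩
    have hsw : ⟪w, S ν⟫_ℝ = ⟪S.symm w, ν⟫_ℝ := by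
      rw [← LinearIsometryEquiv.inner_map_map S (S.symm w) ν, LinearIsometryEquiv.apply_symm_apply]
    rw [hsw]; exact hνm _ (hSmem' w hw)
  have hβSc : List.IsChain (fun μ μ' => ⟪μ, μ'⟫_ℝ = 1 / 3 ∨ ⟪μ, μ'⟫_ℝ = -1 / 3) (β.map S) := by
    rw [List.isChain_map]; simpa only [LinearIsometryEquiv.inner_map_map] using hβc
  have himg₀ : (e₂.frame : EuclideanSpace ℝ (Fin 3) → EuclideanSpace ℝ (Fin 3)) '' ↑fccSlots =
      (wordFrame A₁ (β.map S ++ κ) : EuclideanSpace ℝ (Fin 3) → EuclideanSpace ℝ (Fin 3)) '' ↑fccSlots := by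
    rw [hF₂, hA₂eq, wordFrame_trans (wordFrame A₁ κ) S β (fun μ hμ => (hβl μ hμ).1), ← wordFrame_append,
      image_trans_eq, hSslots]
  have hP2far := stackWord_lastTwo_ne_far (A₂ := A₂) (W := wordFrame A₁ κ) (S := S) (z₂ := z₂) hWS hμ₃.1 hμ₂.1
    hsecond₂ rest₂ e₂ hS₂ hW₂ hl₂
  have hjunction : ∀ x y : EuclideanSpace ℝ (Fin 3),
      (‖x‖ = 1 ∧ ∀ w ∈ fccSlots, ⟪w, x⟫_ℝ = 0 ∨ ⟪w, x⟫_ℝ = Real.sqrt (2 / 3) ∨ ⟪w, x⟫_ℝ = -Real.sqrt (2 / 3)) →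
      (‖y‖ = 1 ∧ ∀ w ∈ fccSlots, ⟪w, y⟫_ℝ = 0 ∨ ⟪w, y⟫_ℝ = Real.sqrt (2 / 3) ∨ ⟪w, y⟫_ℝ = -Real.sqrt (2 / 3)) →
      (ℝ ∙ x)ᗮ.reflection ≠ (ℝ ∙ y)ᗮ.reflection → (⟪x, y⟫_ℝ = 1 / 3 ∨ ⟪x, y⟫_ℝ = -1 / 3) := by
    intro x y hx hy hR; rcases inner_modelMenu hx.1 hy.1 hx.2 hy.2 with h | h | h | h
    · exact absurd (by rw [(inner_eq_one_iff_of_norm_eq_one (𝕜 := ℝ) hx.1 hy.1).1 h]) hR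
    · exact absurd (by rw [eq_neg_of_inner_eq_neg_one' hx.1 hy.1 h, reflection_neg_eq hx.1]) hR
    all_goals simp [h]
  -- P2 in the `≤ 2` form, for the near word, its tail and its one-letter extensions
  have hP2α : ∀ (δ : List (EuclideanSpace ℝ (Fin 3))), (δ = stackWord (e₁ :: rest₁) ∨
      (∃ m', δ = m' :: stackWord (e₁ :: rest₁)) ∨ (∃ a, stackWord (e₁ :: rest₁) = a :: δ)) →
      δ.length ≤ 2 ∨ ∃ (w : List (EuclideanSpace ℝ (Fin 3))) (l₂ l₁ : EuclideanSpace ℝ (Fin 3)),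
        δ = w ++ [l₂, l₁] ∧
        ((ℝ ∙ l₁)ᗮ.reflection ≠ (ℝ ∙ μ₁)ᗮ.reflection ∨ (ℝ ∙ l₂)ᗮ.reflection ≠ (ℝ ∙ μ₂)ᗮ.reflection) := by
    intro δ hδ
    rcases hP2 with h | ⟨w, l₂, l₁, hw, hp⟩
    · left; rcases hδ with rfl | ⟨m', rfl⟩ | ⟨a, ha⟩
      · omega
      · simp only [List.length_cons]; omega
      · have := congrArg List.length ha; simp only [List.length_cons] at this; omega
    · rcases hδ with rfl | ⟨m', rfl⟩ | ⟨a, ha⟩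
      · exact Or.inr ⟨w, l₂, l₁, hw, hp⟩
      · exact Or.inr ⟨m' :: w, l₂, l₁, by rw [hw, List.cons_append], hp⟩
      · cases w with
        | nil => left; rw [hw] at ha; simp at ha; obtain ⟨-, rfl⟩ := ha; simp
        | cons v w' =>
          right; rw [hw] at ha; simp only [List.cons_append, List.cons.injEq] at ha
          exact ⟨w', l₂, l₁, ha.2.symm, hp⟩
  -- the endgame for a far word `γ = γ₀ ++ [μ₂, μ₁]` with `γ₀ ≠ []`
  have absurd_of_far : ∀ γ γ₀ : List (EuclideanSpace ℝ (Fin 3)), γ = γ₀ ++ [μ₂, μ₁] → γ₀ ≠ [] →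
      (∀ μ ∈ γ, ‖μ‖ = 1 ∧
        ∀ w ∈ fccSlots, ⟪w, μ⟫_ℝ = 0 ∨ ⟪w, μ⟫_ℝ = Real.sqrt (2 / 3) ∨ ⟪w, μ⟫_ℝ = -Real.sqrt (2 / 3)) →
      List.IsChain (fun μ μ' => ⟪μ, μ'⟫_ℝ = 1 / 3 ∨ ⟪μ, μ'⟫_ℝ = -1 / 3) γ →
      (e₂.frame : EuclideanSpace ℝ (Fin 3) → EuclideanSpace ℝ (Fin 3)) '' ↑fccSlots =
        (wordFrame A₁ γ : EuclideanSpace ℝ (Fin 3) → EuclideanSpace ℝ (Fin 3)) '' ↑fccSlots → False := by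
    intro γ γ₀ hγ hγ₀ hγl hγc himg₂
    have main : ∀ α : List (EuclideanSpace ℝ (Fin 3)),
        (∀ μ ∈ α, ‖μ‖ = 1 ∧
          ∀ w ∈ fccSlots, ⟪w, μ⟫_ℝ = 0 ∨ ⟪w, μ⟫_ℝ = Real.sqrt (2 / 3) ∨ ⟪w, μ⟫_ℝ = -Real.sqrt (2 / 3)) →
        List.IsChain (fun μ μ' => ⟪μ, μ'⟫_ℝ = 1 / 3 ∨ ⟪μ, μ'⟫_ℝ = -1 / 3) α →
        (α.length ≤ 2 ∨ ∃ (w : List (EuclideanSpace ℝ (Fin 3))) (l₂ l₁ : EuclideanSpace ℝ (Fin 3)),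
          α = w ++ [l₂, l₁] ∧
          ((ℝ ∙ l₁)ᗮ.reflection ≠ (ℝ ∙ μ₁)ᗮ.reflection ∨ (ℝ ∙ l₂)ᗮ.reflection ≠ (ℝ ∙ μ₂)ᗮ.reflection)) →
        (wordFrame A₁ α : EuclideanSpace ℝ (Fin 3) → EuclideanSpace ℝ (Fin 3)) '' ↑fccSlots =
          (wordFrame A₁ γ : EuclideanSpace ℝ (Fin 3) → EuclideanSpace ℝ (Fin 3)) '' ↑fccSlots → False :=
      fun α hl hc hP himg => false_of_map_reflection_eq_two hγ hγ₀ hP (map_reflection_eq_of_image_eq A₁ hl hc hγl hγc himg)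
    rcases eq_or_twin_of_coaxial e₁.frame e₂.frame hco with hEq | ⟨m, hm, hmenu, hEq⟩
    · have himg := image_fccSlots_eq_of_image_fcc_eq _ _ hEq
      rw [hF₁, himg₂] at himg
      exact main _ hαl hαc (hP2α _ (Or.inl rfl)) himg
    · set m' := e₁.frame.symm m with hm'
      have hm'u : ‖m'‖ = 1 := by rw [hm', LinearIsometryEquiv.norm_map, hm]
      have hm'm : ∀ w ∈ fccSlots, ⟪w, m'⟫_ℝ = 0 ∨ ⟪w, m'⟫_ℝ = Real.sqrt (2 / 3) ∨ ⟪w, m'⟫_ℝ = -Real.sqrt (2 / 3) := by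
        intro w hw
        rw [hm', ← LinearIsometryEquiv.inner_map_map e₁.frame, LinearIsometryEquiv.apply_symm_apply]; exact hmenu w hw
      have htw : twinFrame e₁.frame m = wordFrame A₁ (m' :: stackWord (e₁ :: rest₁)) := by
        rw [twinFrame_eq_reflection_trans e₁.frame hm, wordFrame_cons, ← hm', ← hF₁]
      have himg := image_fccSlots_eq_of_image_fcc_eq _ _ hEq
      rw [himg₂, htw] at himg
      cases hα : stackWord (e₁ :: rest₁) with
      | nil =>
        rw [hα] at himg
        exact main [m'] (fun μ hμ => by rw [List.mem_singleton] at hμ; rw [hμ]; exact ⟨hm'u, hm'm⟩)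
          (List.isChain_singleton _) (Or.inl (by simp)) himg.symm
      | cons a α' =>
        rw [hα] at himg hαl hαc
        obtain ⟨hau, ham⟩ := hαl a List.mem_cons_self
        have hPtail := hP2α α' (Or.inr (Or.inr ⟨a, hα⟩))
        have hPfull := hP2α (m' :: a :: α') (Or.inr (Or.inl ⟨m', by rw [hα]⟩))
        rcases inner_modelMenu hm'u hau hm'm ham with h | h | h | h
        · have hma : m' = a := (inner_eq_one_iff_of_norm_eq_one (𝕜 := ℝ) hm'u hau).1 h
          rw [wordFrame_cons_cons_cancel A₁ (by rw [hma]) α'] at himg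
          exact main α' (fun μ hμ => hαl μ (List.mem_cons_of_mem a hμ)) hαc.tail hPtail himg.symm
        · have hma : a = -m' := eq_neg_of_inner_eq_neg_one' hm'u hau h
          have hR : (ℝ ∙ m')ᗮ.reflection = (ℝ ∙ a)ᗮ.reflection := by rw [hma, reflection_neg_eq hm'u]
          rw [wordFrame_cons_cons_cancel A₁ hR α'] at himg
          exact main α' (fun μ hμ => hαl μ (List.mem_cons_of_mem a hμ)) hαc.tail hPtail himg.symm
        all_goals
          refine main (m' :: a :: α') (fun μ hμ => ?_) (List.isChain_cons.2 ⟨fun b hb => ?_, hαc⟩) hPfull himg.symm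
          · rcases List.mem_cons.1 hμ with rfl | hμ'
            · exact ⟨hm'u, hm'm⟩
            · exact hαl μ hμ'
          · rw [List.head?_cons, Option.mem_some_iff] at hb; rw [← hb]; first | exact Or.inl h | exact Or.inr h
  -- CASE ANALYSIS on the far word
  have hκtail_l : ∀ μ ∈ [μ₂, μ₁], ‖μ‖ = 1 ∧ ∀ w ∈ fccSlots, ⟪w, μ⟫_ℝ = 0 ∨ ⟪w, μ⟫_ℝ = Real.sqrt (2 / 3) ∨
      ⟪w, μ⟫_ℝ = -Real.sqrt (2 / 3) := fun μ hμ => hκl μ (by rw [hκdef]; exact List.mem_cons_of_mem μ₃ hμ)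
  have hκtail_c : List.IsChain (fun μ μ' => ⟪μ, μ'⟫_ℝ = 1 / 3 ∨ ⟪μ, μ'⟫_ℝ = -1 / 3) [μ₂, μ₁] := hκc.tail
  rcases List.eq_nil_or_concat β with hβ0 | ⟨L, b₁, hβ1⟩
  · exact (absurd_of_far κ [μ₃] (by rw [hκdef]; rfl) (List.cons_ne_nil _ _) hκl hκc
      (by rw [himg₀, hβ0, List.map_nil, List.nil_append])).elim
  rw [List.concat_eq_append] at hβ1
  have hSb₁ := hβSl (S b₁) (List.mem_map.2 ⟨b₁, by rw [hβ1]; simp, rfl⟩)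
  rcases Classical.em ((ℝ ∙ S b₁)ᗮ.reflection = (ℝ ∙ μ₃)ᗮ.reflection) with hcan | hncan
  swap
  · refine (absurd_of_far (β.map S ++ κ) (β.map S ++ [μ₃]) (by rw [hκdef, List.append_assoc]; rfl) (by simp) ?_ ?_ himg₀).elim
    · intro μ hμ; rcases List.mem_append.1 hμ with h | h
      · exact hβSl μ h
      · exact hκl μ h
    · rw [List.isChain_append]
      refine ⟨hβSc, hκc, fun x hx y hy => ?_⟩
      have hx' : S b₁ = x := by rw [hβ1] at hx; simpa using hx
      rw [← hx', ← (by rw [hκdef] at hy; simpa using hy : μ₃ = y)]; exact hjunction _ _ hSb₁ hμ₃ hncan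
  rcases Classical.em (L = []) with hL | hL
  swap
  · rcases hP2far with hlen | ⟨w, b₂', b₁', hw₀, hdisj⟩
    · exfalso; obtain ⟨l₀, L', rfl⟩ := List.exists_cons_of_ne_nil hL
      rw [← hβ, hβ1] at hlen; simp at hlen
    have hw : β = w ++ [b₂', b₁'] := by rw [hβ]; exact hw₀
    have hb₁' : b₁' = b₁ := by simpa using congrArg List.getLast? (hw.symm.trans hβ1)
    subst hb₁'
    have h2 : (ℝ ∙ S b₂')ᗮ.reflection ≠ (ℝ ∙ μ₂)ᗮ.reflection := hdisj.resolve_left (fun h => h hcan)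
    have hSb₂ := hβSl (S b₂') (List.mem_map.2 ⟨b₂', by rw [hw]; simp, rfl⟩)
    have hpre_mem : ∀ μ ∈ w.map S ++ [S b₂'], μ ∈ β.map S := by
      intro μ hμ; rw [hw, List.map_append, List.map_cons, List.map_cons, List.map_nil]
      rcases List.mem_append.1 hμ with h | h
      · exact List.mem_append_left _ h
      · rw [List.mem_singleton] at h; rw [h]; simp
    have hpre_c : List.IsChain (fun μ μ' => ⟪μ, μ'⟫_ℝ = 1 / 3 ∨ ⟪μ, μ'⟫_ℝ = -1 / 3) (w.map S ++ [S b₂']) := by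
      have h' : β.map S = (w.map S ++ [S b₂']) ++ [S b₁'] := by
        rw [hw, List.map_append, List.map_cons, List.map_cons, List.map_nil, List.append_assoc]; rfl
      rw [h'] at hβSc; exact (List.isChain_append.1 hβSc).1
    refine (absurd_of_far ((w.map S ++ [S b₂']) ++ [μ₂, μ₁]) (w.map S ++ [S b₂']) rfl (by simp) ?_ ?_ ?_).elim
    · intro μ hμ; rcases List.mem_append.1 hμ with h | h
      · exact hβSl μ (hpre_mem μ h)
      · exact hκtail_l μ h
    · rw [List.isChain_append]
      refine ⟨hpre_c, hκtail_c, fun x hx y hy => ?_⟩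
      rw [← (by simpa using hx : S b₂' = x), ← (by simpa using hy : μ₂ = y)]; exact hjunction _ _ hSb₂ hμ₂ h2
    · rw [himg₀, hw, List.map_append, List.map_cons, List.map_cons, List.map_nil, hκdef]
      rw [show (w.map S ++ [S b₂', S b₁']) ++ [μ₃, μ₂, μ₁] = (w.map S ++ [S b₂']) ++ S b₁' :: μ₃ :: [μ₂, μ₁] by simp]
      rw [wordFrame_append_cons_cons_cancel A₁ _ hcan]
  -- THE SURVIVING CASE: `β = [b₁]`, cancelled: the far top's slot dozen is that of `wordFrame A₁ [μ₂, μ₁]` (`T₂`)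
  subst hL
  rw [List.nil_append] at hβ1
  have himgT : (e₂.frame : EuclideanSpace ℝ (Fin 3) → EuclideanSpace ℝ (Fin 3)) '' ↑fccSlots =
      (wordFrame A₁ [μ₂, μ₁] : EuclideanSpace ℝ (Fin 3) → EuclideanSpace ℝ (Fin 3)) '' ↑fccSlots := by
    rw [himg₀, hβ1, List.map_cons, List.map_nil, hκdef, List.singleton_append, wordFrame_cons_cons_cancel A₁ hcan]
  -- comparing with the near word: it must be ONE letter `a` with `R_a = R_{μ₁}`, twin about `μ₂`
  have key₂ : ∀ δ : List (EuclideanSpace ℝ (Fin 3)),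
      (∀ μ ∈ δ, ‖μ‖ = 1 ∧ ∀ w ∈ fccSlots, ⟪w, μ⟫_ℝ = 0 ∨ ⟪w, μ⟫_ℝ = Real.sqrt (2 / 3) ∨ ⟪w, μ⟫_ℝ = -Real.sqrt (2 / 3)) →
      List.IsChain (fun μ μ' => ⟪μ, μ'⟫_ℝ = 1 / 3 ∨ ⟪μ, μ'⟫_ℝ = -1 / 3) δ →
      (wordFrame A₁ δ : EuclideanSpace ℝ (Fin 3) → EuclideanSpace ℝ (Fin 3)) '' ↑fccSlots =
        (wordFrame A₁ [μ₂, μ₁] : EuclideanSpace ℝ (Fin 3) → EuclideanSpace ℝ (Fin 3)) '' ↑fccSlots →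
      ∃ l₂ l₁, δ = [l₂, l₁] ∧ (ℝ ∙ l₁)ᗮ.reflection = (ℝ ∙ μ₁)ᗮ.reflection ∧ (ℝ ∙ l₂)ᗮ.reflection = (ℝ ∙ μ₂)ᗮ.reflection := by
    intro δ hδl hδc himg'
    have hmap := map_reflection_eq_of_image_eq A₁ hδl hδc hκtail_l hκtail_c himg'
    match δ, hmap with
    | [l₂, l₁], hmap =>
      simp only [List.map_cons, List.map_nil, List.cons.injEq, and_true] at hmap
      exact ⟨l₂, l₁, rfl, hmap.2, hmap.1⟩
    | [], hmap => simp at hmap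
    | [_], hmap => simp at hmap
    | _ :: _ :: _ :: _, hmap => have := congrArg List.length hmap; simp at this
  -- P2 forbids the near word to END with `(~μ₂, ~μ₁)`
  have notP : ∀ (w : List (EuclideanSpace ℝ (Fin 3))) (l₂ l₁ : EuclideanSpace ℝ (Fin 3)), stackWord (e₁ :: rest₁) = w ++ [l₂, l₁] →
      (ℝ ∙ l₁)ᗮ.reflection = (ℝ ∙ μ₁)ᗮ.reflection → (ℝ ∙ l₂)ᗮ.reflection = (ℝ ∙ μ₂)ᗮ.reflection → False := by
    intro w l₂ l₁ hw h1 h2; rcases hP2 with h | ⟨w', l₂', l₁', hw', hp⟩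
    · rw [hw, List.length_append] at h; simp at h
    · rw [hw'] at hw
      obtain ⟨-, htail⟩ := List.append_inj hw (by
        have := congrArg List.length hw; simp only [List.length_append, List.length_cons, List.length_nil] at this; omega)
      simp only [List.cons.injEq, and_true] at htail
      obtain ⟨rfl, rfl⟩ := htail
      exact hp.elim (fun h => h h1) (fun h => h h2)
  -- the near word is `[a]` with `R_a = R_{μ₁}` and the twin normal pulls back to `±μ₂`
  obtain ⟨a, hαeq, hRa, m, hm, hmenu, hEqT, hRm⟩ : ∃ a, stackWord (e₁ :: rest₁) = [a] ∧
      (ℝ ∙ a)ᗮ.reflection = (ℝ ∙ μ₁)ᗮ.reflection ∧ ∃ m, ‖m‖ = 1 ∧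
      (∀ w ∈ fccSlots, ⟪e₁.frame w, m⟫_ℝ = 0 ∨ ⟪e₁.frame w, m⟫_ℝ = Real.sqrt (2 / 3) ∨ ⟪e₁.frame w, m⟫_ℝ = -Real.sqrt (2 / 3)) ∧
      e₂.frame '' fccStacking 1 (Real.sqrt (2 / 3)) = twinFrame e₁.frame m '' fccStacking 1 (Real.sqrt (2 / 3)) ∧
      (ℝ ∙ e₁.frame.symm m)ᗮ.reflection = (ℝ ∙ μ₂)ᗮ.reflection := by
    rcases eq_or_twin_of_coaxial e₁.frame e₂.frame hco with hEq | ⟨m, hm, hmenu, hEq⟩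
    · exfalso
      have himg := image_fccSlots_eq_of_image_fcc_eq _ _ hEq
      rw [hF₁, himgT] at himg
      obtain ⟨l₂, l₁, hδ, h1, h2⟩ := key₂ _ hαl hαc himg
      exact notP [] l₂ l₁ (by rw [hδ]; rfl) h1 h2
    · set m' := e₁.frame.symm m with hm'
      have hm'u : ‖m'‖ = 1 := by rw [hm', LinearIsometryEquiv.norm_map, hm]
      have hm'm : ∀ w ∈ fccSlots, ⟪w, m'⟫_ℝ = 0 ∨ ⟪w, m'⟫_ℝ = Real.sqrt (2 / 3) ∨ ⟪w, m'⟫_ℝ = -Real.sqrt (2 / 3) := by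
        intro w hw
        rw [hm', ← LinearIsometryEquiv.inner_map_map e₁.frame, LinearIsometryEquiv.apply_symm_apply]; exact hmenu w hw
      have htw : twinFrame e₁.frame m = wordFrame A₁ (m' :: stackWord (e₁ :: rest₁)) := by
        rw [twinFrame_eq_reflection_trans e₁.frame hm, wordFrame_cons, ← hm', ← hF₁]
      have himg := image_fccSlots_eq_of_image_fcc_eq _ _ hEq
      rw [himgT, htw] at himg
      cases hα : stackWord (e₁ :: rest₁) with
      | nil =>
        exfalso; rw [hα] at himg
        obtain ⟨l₂, l₁, hδ, -, -⟩ := key₂ [m'] (fun μ hμ => by rw [List.mem_singleton] at hμ; rw [hμ]; exact ⟨hm'u, hm'm⟩)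
          (List.isChain_singleton _) himg.symm
        simp at hδ
      | cons a α' =>
        rw [hα] at himg hαl hαc
        obtain ⟨hau, ham⟩ := hαl a List.mem_cons_self
        rcases inner_modelMenu hm'u hau hm'm ham with h | h | h | h
        · exfalso
          have hma : m' = a := (inner_eq_one_iff_of_norm_eq_one (𝕜 := ℝ) hm'u hau).1 h
          rw [wordFrame_cons_cons_cancel A₁ (by rw [hma]) α'] at himg
          obtain ⟨l₂, l₁, hδ, h1, h2⟩ := key₂ α' (fun μ hμ => hαl μ (List.mem_cons_of_mem a hμ)) hαc.tail himg.symm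
          exact notP [a] l₂ l₁ (by rw [hα, hδ]; rfl) h1 h2
        · exfalso
          have hma : a = -m' := eq_neg_of_inner_eq_neg_one' hm'u hau h
          have hR : (ℝ ∙ m')ᗮ.reflection = (ℝ ∙ a)ᗮ.reflection := by rw [hma, reflection_neg_eq hm'u]
          rw [wordFrame_cons_cons_cancel A₁ hR α'] at himg
          obtain ⟨l₂, l₁, hδ, h1, h2⟩ := key₂ α' (fun μ hμ => hαl μ (List.mem_cons_of_mem a hμ)) hαc.tail himg.symm
          exact notP [a] l₂ l₁ (by rw [hα, hδ]; rfl) h1 h2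
        all_goals
          obtain ⟨l₂, l₁, hδ, h1, h2⟩ := key₂ (m' :: a :: α') (fun μ hμ => by
              rcases List.mem_cons.1 hμ with rfl | hμ'
              · exact ⟨hm'u, hm'm⟩
              · exact hαl μ hμ')
            (List.isChain_cons.2 ⟨fun b hb => by
              rw [List.head?_cons, Option.mem_some_iff] at hb; rw [← hb]; first | exact Or.inl h | exact Or.inr h, hαc⟩)
            himg.symm
          simp only [List.cons.injEq] at hδ
          obtain ⟨rfl, rfl, hnil⟩ := hδ
          exact ⟨a, by rw [hnil], h1, m, hm, hmenu, hEq, h2⟩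
  -- so `rest₁ = [bottom₁]`, `e₁` is grain 1's level-one entry through `±A₁μ₁`
  have hlen₁ : rest₁.length = 1 := by
    have := length_stackWord_cons rest₁ e₁; rw [hαeq] at this; simpa using this.symm
  obtain ⟨b, rfl⟩ := List.length_eq_one_iff.1 hlen₁
  obtain rfl : b = ⟨A₁, u₁, 0⟩ := by simpa using hl₁
  obtain ⟨hSo₁, hLi₁, -⟩ := hS₁
  obtain ⟨hdir₁, -, -⟩ := (stackWF_cons_cons z₁ e₁ ⟨A₁, u₁, 0⟩ []).1 hW₁
  have hn₁ : ‖e₁.nrm‖ = 1 := hSo₁.2.1; have hfr₁ := frame_eq_twinFrame_of_link (e := e₁) (e' := ⟨A₁, u₁, 0⟩) hn₁ hLi₁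
  have haeq : a = (A₁ : EuclideanSpace ℝ (Fin 3) ≃ₗᵢ[ℝ] EuclideanSpace ℝ (Fin 3)).symm e₁.nrm := by
    have : stackWord [e₁, ⟨A₁, u₁, 0⟩] = [(A₁ : EuclideanSpace ℝ (Fin 3) ≃ₗᵢ[ℝ] EuclideanSpace ℝ (Fin 3)).symm e₁.nrm] := by
      rw [stackWord_cons_cons, stackWord_singleton]
    rw [hαeq] at this; simpa using this
  have hpm₁ : e₁.nrm = A₁ μ₁ ∨ e₁.nrm = -A₁ μ₁ := by
    have hu : ‖(A₁ : EuclideanSpace ℝ (Fin 3) ≃ₗᵢ[ℝ] EuclideanSpace ℝ (Fin 3)).symm e₁.nrm‖ = 1 := by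
      rw [LinearIsometryEquiv.norm_map, hn₁]
    rw [haeq] at hRa
    rcases eq_or_eq_neg_of_reflection_eq hu hμ₁.1 hRa with h | h
    · left; rw [← h, LinearIsometryEquiv.apply_symm_apply]
    · right; rw [← LinearIsometryEquiv.apply_symm_apply A₁ e₁.nrm, h, map_neg]
  have hSne₁ : (fccSlots.filter fun q => 0 < ⟪twinFrame A₁ e₁.nrm q, e₁.nrm⟫_ℝ).Nonempty := by
    obtain ⟨p, hp, hpn, -⟩ := exists_pos_slot_ne (twinFrame A₁ e₁.nrm) hn₁ (by rw [← hfr₁]; exact hSo₁.2.2.1) 0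
    exact ⟨p, Finset.mem_filter.2 ⟨hp, by rw [hpn]; exact hr⟩⟩
  obtain ⟨hqS₁, hqmax₁⟩ := bestCapper_spec (twinFrame A₁ e₁.nrm) e₁.nrm z₁ hSne₁; rw [Finset.mem_filter] at hqS₁
  have hd₁ : ⟪e₁.dir, μ₂⟫_ℝ = 0 := by
    rw [hdir₁, hfr₁]; exact hcap₁ e₁.nrm hpm₁ hLi₁.2 _ hqS₁.1 hqS₁.2 (fun q' hq' hpos' => hqmax₁ q' (Finset.mem_filter.2 ⟨hq', hpos'⟩))
  -- the mirror: `m' = ±μ₂`, so `twinFrame e₁.frame m = twinFrame e₁.frame (e₁.frame μ₂)`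
  have hm₂u : ‖e₁.frame μ₂‖ = 1 := by rw [LinearIsometryEquiv.norm_map, hμ₂.1]
  have hmsame : twinFrame e₁.frame m = twinFrame e₁.frame (e₁.frame μ₂) := by
    have hu : ‖e₁.frame.symm m‖ = 1 := by rw [LinearIsometryEquiv.norm_map, hm]
    refine LinearIsometryEquiv.ext fun x => ?_
    rw [twinFrame_apply e₁.frame hm, twinFrame_apply e₁.frame hm₂u]
    rcases eq_or_eq_neg_of_reflection_eq hu hμ₂.1 hRm with h | h
    · rw [(by rw [← h, LinearIsometryEquiv.apply_symm_apply] : m = e₁.frame μ₂)]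
    · rw [(by rw [← map_neg, ← h, LinearIsometryEquiv.apply_symm_apply] : m = -e₁.frame μ₂), inner_neg_right, mul_neg,
        neg_smul, smul_neg, neg_neg]
  -- `rest₂ = [bottom₂]`: `e₂` is grain 2's level-one entry through `±W μ₃`, its direction the far best capper
  have hlen₂ : rest₂.length = 1 := by
    have := length_stackWord_cons rest₂ e₂; rw [← hβ, hβ1] at this; simpa using this.symm
  obtain ⟨b', rfl⟩ := List.length_eq_one_iff.1 hlen₂
  obtain rfl : b' = ⟨A₂, u₂, 0⟩ := by simpa using hl₂
  obtain ⟨hSo₂, hLi₂, -⟩ := hS₂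
  obtain ⟨hdir₂, -, -⟩ := (stackWF_cons_cons z₂ e₂ ⟨A₂, u₂, 0⟩ []).1 hW₂
  have hn₂ : ‖e₂.nrm‖ = 1 := hSo₂.2.1; have hfr₂ := frame_eq_twinFrame_of_link (e := e₂) (e' := ⟨A₂, u₂, 0⟩) hn₂ hLi₂
  have hSb₁eq : S b₁ = (wordFrame A₁ κ).symm e₂.nrm := by
    have : β = [(A₂ : EuclideanSpace ℝ (Fin 3) ≃ₗᵢ[ℝ] EuclideanSpace ℝ (Fin 3)).symm e₂.nrm] := by
      rw [hβ, stackWord_cons_cons, stackWord_singleton]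
    rw [hβ1] at this
    have hb : b₁ = (A₂ : EuclideanSpace ℝ (Fin 3) ≃ₗᵢ[ℝ] EuclideanSpace ℝ (Fin 3)).symm e₂.nrm := by simpa using this
    rw [hb, hS, LinearIsometryEquiv.trans_apply, LinearIsometryEquiv.apply_symm_apply]
  have hpm₂ : e₂.nrm = wordFrame A₁ κ μ₃ ∨ e₂.nrm = -wordFrame A₁ κ μ₃ := by
    have hu : ‖(wordFrame A₁ κ).symm e₂.nrm‖ = 1 := by rw [LinearIsometryEquiv.norm_map, hn₂]
    rw [hSb₁eq] at hcan
    rcases eq_or_eq_neg_of_reflection_eq hu hμ₃.1 hcan with h | h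
    · left; rw [← h, LinearIsometryEquiv.apply_symm_apply]
    · right; rw [← LinearIsometryEquiv.apply_symm_apply (wordFrame A₁ κ) e₂.nrm, h, map_neg]
  have hSne₂ : (fccSlots.filter fun q => 0 < ⟪twinFrame A₂ e₂.nrm q, e₂.nrm⟫_ℝ).Nonempty := by
    obtain ⟨p, hp, hpn, -⟩ := exists_pos_slot_ne (twinFrame A₂ e₂.nrm) hn₂ (by rw [← hfr₂]; exact hSo₂.2.2.1) 0
    exact ⟨p, Finset.mem_filter.2 ⟨hp, by rw [hpn]; exact hr⟩⟩
  obtain ⟨hqS₂, hqmax₂⟩ := bestCapper_spec (twinFrame A₂ e₂.nrm) e₂.nrm z₂ hSne₂; rw [Finset.mem_filter] at hqS₂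
  have hd₂ : ⟪e₂.frame e₂.dir, twinFrame A₁ (A₁ μ₁) μ₂⟫_ℝ = 0 := by
    rw [hdir₂, hfr₂]; exact hcap₂ e₂.nrm hpm₂ hLi₂.2 _ hqS₂.1 hqS₂.2 (fun q' hq' hpos' => hqmax₂ q' (Finset.mem_filter.2 ⟨hq', hpos'⟩))
  -- `e₁.frame μ₂ = twinFrame A₁ (A₁μ₁) μ₂` (the twin frame does not see the sign of its normal)
  have hν : e₁.frame μ₂ = twinFrame A₁ (A₁ μ₁) μ₂ := by
    have h1 : ‖A₁ μ₁‖ = 1 := by rw [LinearIsometryEquiv.norm_map, hμ₁.1]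
    rw [hfr₁, twinFrame_apply A₁ hn₁, twinFrame_apply A₁ h1]
    rcases hpm₁ with h | h
    · rw [h]
    · rw [h, inner_neg_right, mul_neg, neg_smul, smul_neg, neg_neg]
  refine ⟨e₁.frame μ₂, hm₂u, fun w hw => by rw [LinearIsometryEquiv.inner_map_map]; exact hμ₂.2 w hw, ?_, ?_, by rw [hν]; exact hd₂⟩
  · rw [← hmsame]; exact hEqT
  · rw [LinearIsometryEquiv.inner_map_map]; exact hd₁

end Summit.Ventures.Crystal3D.Theorems

end
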